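import Summits.QuantumFields.YangMills.Theorems.BalabanUVNodesN07KLHOfThm312
import HarnessLib

/-!
# BalabanUVNodes ∕ N07 — THE KERNEL-ENTRY BOOKKEEPING OF RECORD, LETTER-GENERIC: for ANY right-inverse-type operator
# `T : |·|₍₋₀₎ on the k-bonds →L[ℂ] (115)` (and any current reader `S : (115) →L[ℂ] |·|₍₋₃₎`), the columns, the (3.133)∕(130)-shape block-sup entries, the two
# pointwise pins, and — in the node-00 regime — (ℓa-H) `Prop4LetterH T b`, PT-B G1's (KL-H) binders for `T` and (KL-N) binders for `S ∘ T` from DISPLAYED per-member entry decay rows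

Track A of `YM-PLAN.md` (cell `pub-ymgap`, HUMAN RULING D-0062), DAG node **N07** = [Balaban1985Variational] («[B11]», CMP **102** (1985) 277–309); [B9] =
[Balaban1985BackgroundPropagators]; [4] = [Balaban1984PropagatorsII].  Seat `pub-ymgap-dag-n07-e` (g39), ★★★ director-ym №603 (1) («(KL-H)∕(3.133) rows at the FRAMED triple: (S) or
(M)?») — answer «(M) once, then (S)»: THIS is the one re-press.  `--supports stmt-QuantumFields-27238 --as helper`; count-neutral.

WHY.  The landed N07 rows ✓`…N07Prop4LetterHOfThm312` §1–§3 (MODULE 145), ✓`…N07KLNOfEntryBounds` (147) and dag-n06-l's ✓`…N07KLHOfThm312` are keyed to the CONSTANT frame-free letter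
`H1OfRecordAtBgFlat` (slot (a), letters `(QOfRecord U₀, Q′♭)`), at which the k-uniform displays are LOCATED FALSE-AT-SCALE (node00-def-Y g40, pub-ymgap INBOX 2026-08-31 ≈16:20Z,
«LOCATED-H♭»: at `U₀ = 1` the frame-free `H₁♭` is point-pinned biharmonic interpolation on pure gauges, H²-critical in d = 4, sup-entry ≍ `L^k∕k`); their PROOFS use nothing about WHICH
operator.  This file states them for an ARBITRARY `T` (resp. `S ∘ T`), so that def-Y's (ρ-frame-min) edition (the FRAMED `H₁^{pr}` at `(Q^{pr}, QprimeOfRecord)`, print's pair, where [B9]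
Thm 3.12∕(3.133) and [B11] (46)∕(103) ARE the printed statements) and any other pin are INSTANTIATIONS.  Nothing of 145∕147∕n06-l is restated: their frame-free decls stay as landed (the
`T := H1OfRecordAtBgFlat …` instances, historical; use of their k-uniform family theorems is HELD per LOCATED-H♭).

WHAT (node-00 = `∀ x, x ∈ Ω k`; standing range `k ≤ m + K` where fibres are counted; `d` = `Site.tdist` of the sources; `V := M_N(ℂ)`):
* §1 `colOp T y x`, `colOp1 T y p` — the value∕∇ columns `X ↦ (T(δ_y X))(x)`, `X ↦ (∇_{U₀}T(δ_y X))(p)` (`V →L[ℂ] V`); `_apply`; `eval_eq_sum_colOp`, `nabla_eq_sum_colOp1` (`(TB)(x) = Σ_y colOp T y x (B y)`).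
* §2 `entry0 T y″ y`, `entry1 T y″ y` — block sups «sup_{x∈Δ(y″)}|T_{μν}(x, y)|» (lit `fsup`); `opNorm_colOp_le_entry0∕1`; ★ PINS `norm_eval_le`, `norm_nabla_le` — `T`, `∇T` READ by their entries.
* §3 ★★★ `prop4LetterH_of_entryBounds` — `entryₙ T y″ y ≤ B₀e^{−ρd(y″,y)}` (n = 0,1) ⟹ `Prop4LetterH T (B₀·d(2(1+1∕ρ))^d)` (def-Y's generic letter; [B11] (46)∕(103) with `B₀` × the (2.61) row sum).
* §4 ★★ `klH_of_entryBounds` — the zeroth row alone ⟹ PT-B G1's six (KL-H) binders at `hk(b′, y) := ‖colOp T y b′‖_op`, `Θ_H = Θ_H^w := (L^d)^k·B₀·d(2(1+1∕ρ))^d` (n06-l's fibre count + row sum).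
* §5 `nColOp S T y b′`, `nEntry0 S T y″ y`, ★★ `klN_of_nEntryBounds` — for `S : (115) →L[ℂ] |·|₍₋₃₎` (e.g. `DeltaPiCurOfRecord … Gp Q′`): PT-B G1's six (KL-N) binders at `hk′ := ‖nColOp S T y b′‖_op`,
  `Θ′ := (L^d)^k·B₀·d(2(1+1∕ρ))^d`, `N₁ := B₀·d(2(1+1∕ρ))^d`, from `nEntry0 S T y″ y ≤ B₀e^{−ρd(y″,y)}`.
HONEST FRAMING.  Letter-generic BOOKKEEPING (finite sums, operator norms, one geometric series, a fibre count); every analytic row is a DISPLAYED per-member hypothesis on the abstract `T`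
(no `B9.*Printed` family display here — those re-press at the framed instance when def-Y's defs land); nothing of [B9]∕[B11] proved; K0ᴬ ⟨27238⟩ NOT closed; COUNT 8∕28 · K 1∕4 UNMOVED;
one finite 𝕋⁴ programme at fixed ε — NOT continuum ∕ OS ∕ Clay; **the Yang–Mills mass gap is NOT proved by any of this.**  No `sorry`, no `instance`, no `notation`; standard axioms.
-/

noncomputable section
open scoped Matrix Matrix.Norms.L2Operator InnerProductSpace ComplexConjugate BigOperators
namespace Summit.QuantumFields.YangMills.BalabanUVNodes.N07KernelEntriesOfRecord

open Literature.MathematicalPhysics.QuantumFieldTheory.Balaban1983to89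
open Literature.MathematicalPhysics.QuantumFieldTheory.Balaban1983to89.Node00
open T4Continuum (T4Family)
open B9SectCLatticeCarrier (Bond)
open B11Eq115Space (NegSup NegSize Space115 JetSup levWeight levWeight_apply)
open B11Eq111FrakG (nabla115)
open B11Eq90V0primeCurrent (flat115 flat115_apply)
open B11KernelDictionary (fsup le_fsup fsup_nonneg)
open Summit.QuantumFields.YangMills.Theorems.C44IterMh (levWeight_bondLevLit_eq_one levWeight_pairLevLit_eq_one)
open Summit.QuantumFields.YangMills.BalabanUVNodes.N07Prop4LetterHOfThm312 (singleBIdx singleBIdx_apply sum_singleBIdx blkOfBond rowSum_PBond_le tdist_comm_rec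
  norm_apply_le_of_weightZero)
open Summit.QuantumFields.YangMills.BalabanUVNodes.N07KLHOfThm312 (sum_over_blocks_le levWeight_bondLevLit_eq_one_pow)

variable (F : T4Family) (N : ℕ) (K k : ℕ) (Ω : ℕ → Set (Site (F.P K) 0)) (U₀ : GaugeField (F.P K) 0 (SU N)) (levB : PBond (F.P K) k → ℕ)
variable [Fact (0 < (F.L : ℝ))] [Fact (0 < (F.P K).eta k)]
variable (T : NegSize (F.L : ℝ) ((F.P K).eta k) levB 0 (Matrix (Fin N) (Fin N) ℂ) →L[ℂ] Space115Lit F N K k Ω U₀)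

/-! ## §1 The columns of an arbitrary `T` -/

/-- **THE VALUE COLUMN** `X ↦ (T(δ_y X))(x) : V →L[ℂ] V` of `T` at the B-index `y` and the fine bond `x` — print's kernel entry `T_{μν}(x, y)` as a colour operator (top-level pairing volume `1`).
[cite: Balaban1985BackgroundPropagators, (3.133) p.422; Balaban1985Variational, (45) p.285] -/
def colOp (y : PBond (F.P K) k) (x : Bond (F.P K).d (fun _ => (F.P K).sitesPerDir 0)) : Matrix (Fin N) (Fin N) ℂ →L[ℂ] Matrix (Fin N) (Fin N) ℂ :=
  LinearMap.toContinuousLinearMap ((JetSup.evalCLM (levWeight (F.L : ℝ) ((F.P K).eta k) (bondLevLit F Ω k) 1) (levWeight (F.L : ℝ) ((F.P K).eta k) (pairLevLit F Ω k) 2) (nabla115 ((F.P K).eta k) (unitsOfRecord F N U₀)) x).toLinearMap ∘ₗ T.toLinearMap ∘ₗ singleBIdx F N K k levB y)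

/-- **THE ∇-COLUMN** `X ↦ (∇_{U₀}T(δ_y X))(p)`, `∇_{U₀} := nabla115 η_k (unitsOfRecord U₀)`. [cite: Balaban1985BackgroundPropagators, (3.3) p.390, (3.133) p.422] -/
def colOp1 (y : PBond (F.P K) k) (p : Bond (F.P K).d (fun _ => (F.P K).sitesPerDir 0) × Fin (F.P K).d) : Matrix (Fin N) (Fin N) ℂ →L[ℂ] Matrix (Fin N) (Fin N) ℂ :=
  LinearMap.toContinuousLinearMap ((NegSup.evalCLM ℂ (levWeight (F.L : ℝ) ((F.P K).eta k) (pairLevLit F Ω k) 2) p).toLinearMap ∘ₗ (JetSup.sndCLM (levWeight (F.L : ℝ) ((F.P K).eta k) (bondLevLit F Ω k) 1) (levWeight (F.L : ℝ) ((F.P K).eta k) (pairLevLit F Ω k) 2) (nabla115 ((F.P K).eta k) (unitsOfRecord F N U₀))).toLinearMap ∘ₗ T.toLinearMap ∘ₗ singleBIdx F N K k levB y)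

/-- Unfolding `colOp`. [cite: Balaban1985BackgroundPropagators, (3.133) p.422 (bookkeeping)] -/
theorem colOp_apply (y : PBond (F.P K) k) (x : Bond (F.P K).d (fun _ => (F.P K).sitesPerDir 0)) (X : Matrix (Fin N) (Fin N) ℂ) :
    colOp F N K k Ω U₀ levB T y x X = JetSup.equiv _ _ _ (T (singleBIdx F N K k levB y X)) x := rfl

/-- Unfolding `colOp1`. [cite: Balaban1985BackgroundPropagators, (3.133) p.422 (bookkeeping)] -/
theorem colOp1_apply (y : PBond (F.P K) k) (p : Bond (F.P K).d (fun _ => (F.P K).sitesPerDir 0) × Fin (F.P K).d) (X : Matrix (Fin N) (Fin N) ℂ) :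
    colOp1 F N K k Ω U₀ levB T y p X = (nabla115 ((F.P K).eta k) (unitsOfRecord F N U₀)) (JetSup.equiv _ _ _ (T (singleBIdx F N K k levB y X))) p := rfl

/-- **`(TB)(x) = Σ_y colOp T y x (B y)`** (linearity over `B = Σ_y δ_y(B y)`). [cite: Balaban1985BackgroundPropagators, (3.133) p.422 (bookkeeping)] -/
theorem eval_eq_sum_colOp (b : NegSize (F.L : ℝ) ((F.P K).eta k) levB 0 (Matrix (Fin N) (Fin N) ℂ)) (x : Bond (F.P K).d (fun _ => (F.P K).sitesPerDir 0)) :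
    JetSup.equiv _ _ _ (T b) x = ∑ y : PBond (F.P K) k, colOp F N K k Ω U₀ levB T y x (NegSup.equiv _ _ b y) := by
  rw [show JetSup.equiv _ _ _ (T b) x = JetSup.evalCLM (levWeight (F.L : ℝ) ((F.P K).eta k) (bondLevLit F Ω k) 1) (levWeight (F.L : ℝ) ((F.P K).eta k) (pairLevLit F Ω k) 2) (nabla115 ((F.P K).eta k) (unitsOfRecord F N U₀)) x (T b) from rfl]
  conv_lhs => rw [← sum_singleBIdx F N K k levB b]
  rw [map_sum, map_sum]
  rfl

/-- **`(∇_{U₀}TB)(p) = Σ_y colOp1 T y p (B y)`**. [cite: Balaban1985BackgroundPropagators, (3.133) p.422 (bookkeeping)] -/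
theorem nabla_eq_sum_colOp1 (b : NegSize (F.L : ℝ) ((F.P K).eta k) levB 0 (Matrix (Fin N) (Fin N) ℂ)) (p : Bond (F.P K).d (fun _ => (F.P K).sitesPerDir 0) × Fin (F.P K).d) :
    (nabla115 ((F.P K).eta k) (unitsOfRecord F N U₀)) (JetSup.equiv _ _ _ (T b)) p = ∑ y : PBond (F.P K) k, colOp1 F N K k Ω U₀ levB T y p (NegSup.equiv _ _ b y) := by
  rw [show (nabla115 ((F.P K).eta k) (unitsOfRecord F N U₀)) (JetSup.equiv _ _ _ (T b)) p = NegSup.evalCLM ℂ (levWeight (F.L : ℝ) ((F.P K).eta k) (pairLevLit F Ω k) 2) p (JetSup.sndCLM (levWeight (F.L : ℝ) ((F.P K).eta k) (bondLevLit F Ω k) 1) (levWeight (F.L : ℝ) ((F.P K).eta k) (pairLevLit F Ω k) 2) (nabla115 ((F.P K).eta k) (unitsOfRecord F N U₀)) (T b)) from rfl]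
  conv_lhs => rw [← sum_singleBIdx F N K k levB b]
  rw [map_sum, map_sum, map_sum]
  rfl

/-! ## §2 Block-sup entries and the two pointwise pins -/

open Classical in
/-- **`sup_{x∈Δ(y″)}|T_{μν}(x, y)|`** — the zeroth (3.133)-shape entry of `T` (block sup of the column operator norms, lit `fsup`). [cite: Balaban1985BackgroundPropagators, (3.133) p.422] -/
def entry0 (y'' y : PBond (F.P K) k) : ℝ :=
  fsup fun x : Bond (F.P K).d (fun _ => (F.P K).sitesPerDir 0) => if blkOfBond F K k x = y'' then ‖colOp F N K k Ω U₀ levB T y x‖ else 0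

open Classical in
/-- **`sup_{x∈Δ(y″)}|∇T_{μν}(x, y)|`** — the first (3.133)-shape entry of `T`. [cite: Balaban1985BackgroundPropagators, (3.133) p.422] -/
def entry1 (y'' y : PBond (F.P K) k) : ℝ :=
  fsup fun p : Bond (F.P K).d (fun _ => (F.P K).sitesPerDir 0) × Fin (F.P K).d => if blkOfBond F K k p.1 = y'' then ‖colOp1 F N K k Ω U₀ levB T y p‖ else 0

/-- `‖colOp T y x‖ ≤ entry0 T Δ⁻¹(x) y`. [cite: Balaban1985BackgroundPropagators, (3.133) p.422 (bookkeeping)] -/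
theorem opNorm_colOp_le_entry0 (y : PBond (F.P K) k) (x : Bond (F.P K).d (fun _ => (F.P K).sitesPerDir 0)) :
    ‖colOp F N K k Ω U₀ levB T y x‖ ≤ entry0 F N K k Ω U₀ levB T (blkOfBond F K k x) y := by
  classical
  unfold entry0
  refine le_trans (le_of_eq ?_) (le_fsup _ x)
  rw [if_pos rfl]

/-- `‖colOp1 T y p‖ ≤ entry1 T Δ⁻¹(p) y`. [cite: Balaban1985BackgroundPropagators, (3.133) p.422 (bookkeeping)] -/
theorem opNorm_colOp1_le_entry1 (y : PBond (F.P K) k) (p : Bond (F.P K).d (fun _ => (F.P K).sitesPerDir 0) × Fin (F.P K).d) :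
    ‖colOp1 F N K k Ω U₀ levB T y p‖ ≤ entry1 F N K k Ω U₀ levB T (blkOfBond F K k p.1) y := by
  classical
  unfold entry1
  refine le_trans (le_of_eq ?_) (le_fsup _ p)
  rw [if_pos rfl]

/-- ★ **PIN 0**: `‖(TB)(x)‖ ≤ (Σ_y entry0 T Δ⁻¹(x) y)·|B|`. [cite: Balaban1985BackgroundPropagators, (3.133) p.422; Balaban1984PropagatorsII, (2.52)–(2.55) pp.232–233] -/
theorem norm_eval_le (b : NegSize (F.L : ℝ) ((F.P K).eta k) levB 0 (Matrix (Fin N) (Fin N) ℂ)) (x : Bond (F.P K).d (fun _ => (F.P K).sitesPerDir 0)) :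
    ‖JetSup.equiv _ _ _ (T b) x‖ ≤ (∑ y : PBond (F.P K) k, entry0 F N K k Ω U₀ levB T (blkOfBond F K k x) y) * ‖b‖ := by
  rw [eval_eq_sum_colOp, Finset.sum_mul]
  refine (norm_sum_le _ _).trans (Finset.sum_le_sum fun y _ => ?_)
  calc ‖colOp F N K k Ω U₀ levB T y x (NegSup.equiv _ _ b y)‖
      ≤ ‖colOp F N K k Ω U₀ levB T y x‖ * ‖NegSup.equiv _ _ b y‖ := ContinuousLinearMap.le_opNorm _ _
    _ ≤ entry0 F N K k Ω U₀ levB T (blkOfBond F K k x) y * ‖b‖ :=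
        mul_le_mul (opNorm_colOp_le_entry0 F N K k Ω U₀ levB T y x) (norm_apply_le_of_weightZero F N K k levB b y) (norm_nonneg _) (fsup_nonneg _)

/-- ★ **PIN 1**: `‖(∇_{U₀}TB)(p)‖ ≤ (Σ_y entry1 T Δ⁻¹(p) y)·|B|`. [cite: Balaban1985BackgroundPropagators, (3.133) p.422; Balaban1984PropagatorsII, (2.52)–(2.55) pp.232–233] -/
theorem norm_nabla_le (b : NegSize (F.L : ℝ) ((F.P K).eta k) levB 0 (Matrix (Fin N) (Fin N) ℂ)) (p : Bond (F.P K).d (fun _ => (F.P K).sitesPerDir 0) × Fin (F.P K).d) :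
    ‖(nabla115 ((F.P K).eta k) (unitsOfRecord F N U₀)) (JetSup.equiv _ _ _ (T b)) p‖ ≤ (∑ y : PBond (F.P K) k, entry1 F N K k Ω U₀ levB T (blkOfBond F K k p.1) y) * ‖b‖ := by
  rw [nabla_eq_sum_colOp1, Finset.sum_mul]
  refine (norm_sum_le _ _).trans (Finset.sum_le_sum fun y _ => ?_)
  calc ‖colOp1 F N K k Ω U₀ levB T y p (NegSup.equiv _ _ b y)‖
      ≤ ‖colOp1 F N K k Ω U₀ levB T y p‖ * ‖NegSup.equiv _ _ b y‖ := ContinuousLinearMap.le_opNorm _ _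
    _ ≤ entry1 F N K k Ω U₀ levB T (blkOfBond F K k p.1) y * ‖b‖ :=
        mul_le_mul (opNorm_colOp1_le_entry1 F N K k Ω U₀ levB T y p) (norm_apply_le_of_weightZero F N K k levB b y) (norm_nonneg _) (fsup_nonneg _)

/-! ## §3 (ℓa-H) for `T`: the letter from (3.133)-shaped entry bounds, node-00 -/

/-- ★★★ **`Prop4LetterH T b` FROM ENTRY BOUNDS (node-00)**: `entryₙ T y″ y ≤ B₀e^{−ρd(y″,y)}` (n = 0, 1) ⟹ `∀ B, ‖TB‖₍₁₁₅₎ ≤ B₀·d(2(1+1∕ρ))^d·|B|` — [B11] (46)∕(103)'s shape with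
print's `B₀` × the (2.61) row-sum constant; weights `= 1` at the top level. [cite: Balaban1985Variational, (46) p.285, (103) p.293, (115) p.294; Balaban1985BackgroundPropagators, (3.133) p.422; Balaban1984PropagatorsII, (2.61) p.234] -/
theorem prop4LetterH_of_entryBounds (hΩ : ∀ x, x ∈ Ω k) {B₀ ρ : ℝ} (hB₀ : 0 ≤ B₀) (hρ : 0 < ρ)
    (h0 : ∀ y'' y : PBond (F.P K) k, entry0 F N K k Ω U₀ levB T y'' y ≤ B₀ * Real.exp (-(ρ * (Site.tdist y''.src y.src : ℝ))))
    (h1 : ∀ y'' y : PBond (F.P K) k, entry1 F N K k Ω U₀ levB T y'' y ≤ B₀ * Real.exp (-(ρ * (Site.tdist y''.src y.src : ℝ)))) :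
    Prop4LetterH T (B₀ * ((F.P K).d * (2 * (1 + 1 / ρ)) ^ (F.P K).d)) := by
  have hC0 : (0 : ℝ) ≤ (F.P K).d * (2 * (1 + 1 / ρ)) ^ (F.P K).d := by positivity
  have hrow : ∀ y : PBond (F.P K) k,
      ∑ y' : PBond (F.P K) k, B₀ * Real.exp (-(ρ * (Site.tdist y.src y'.src : ℝ))) ≤ B₀ * ((F.P K).d * (2 * (1 + 1 / ρ)) ^ (F.P K).d) :=
    fun y => by rw [← Finset.mul_sum]; exact mul_le_mul_of_nonneg_left (rowSum_PBond_le F K k y hρ) hB₀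
  intro b
  have hb : 0 ≤ B₀ * ((F.P K).d * (2 * (1 + 1 / ρ)) ^ (F.P K).d) * ‖b‖ := mul_nonneg (mul_nonneg hB₀ hC0) (norm_nonneg b)
  refine (JetSup.norm_le_iff_pointwise (f := T b) hb).2 ⟨fun x => ?_, fun p => ?_⟩
  · rw [levWeight_bondLevLit_eq_one F k Ω hΩ x, one_mul]
    refine (norm_eval_le F N K k Ω U₀ levB T b x).trans (mul_le_mul_of_nonneg_right ?_ (norm_nonneg b))
    exact (Finset.sum_le_sum fun y _ => h0 _ y).trans (hrow _)
  · rw [levWeight_pairLevLit_eq_one F K k Ω hΩ p, one_mul]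
    refine (norm_nabla_le F N K k Ω U₀ levB T b p).trans (mul_le_mul_of_nonneg_right ?_ (norm_nonneg b))
    exact (Finset.sum_le_sum fun y _ => h1 _ y).trans (hrow _)

/-! ## §4 (KL-H) for `T`: PT-B G1's one-block letter from the zeroth entry row -/

/-- G1's reading `flat115 (T(δ_y Z)) b′` IS the column. [cite: Balaban1985BackgroundPropagators, (3.133) p.422 (bookkeeping)] -/
theorem flat115_single (y : PBond (F.P K) k) (Z : Matrix (Fin N) (Fin N) ℂ) (b' : Bond (F.P K).d (fun _ => (F.P K).sitesPerDir 0)) :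
    flat115 (T ((NegSup.equiv (levWeight (F.L : ℝ) ((F.P K).eta k) levB 0) (Matrix (Fin N) (Fin N) ℂ)).symm (Pi.single y Z))) b' = colOp F N K k Ω U₀ levB T y b' Z := by
  rw [flat115_apply, colOp_apply]
  rfl

/-- `Σ_{b′} ‖colOp T y b′‖ ≤ (L^d)^k · Σ_{y″} entry0 T y″ y` (n06-l's fibre count). [cite: Balaban1984PropagatorsII, (2.52) p.232; Balaban1985BackgroundPropagators, (3.133) p.422] -/
theorem sum_opNorm_colOp_le (hk : k ≤ (F.P K).m + (F.P K).K) (y : PBond (F.P K) k) :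
    ∑ b' : Bond (F.P K).d (fun _ => (F.P K).sitesPerDir 0), ‖colOp F N K k Ω U₀ levB T y b'‖ ≤ (((F.P K).L ^ (F.P K).d) ^ k : ℕ) * ∑ y'' : PBond (F.P K) k, entry0 F N K k Ω U₀ levB T y'' y := by
  refine le_trans (Finset.sum_le_sum fun b' _ => opNorm_colOp_le_entry0 F N K k Ω U₀ levB T y b') ?_
  exact sum_over_blocks_le F K k hk (fun y'' => entry0 F N K k Ω U₀ levB T y'' y) (fun _ => fsup_nonneg _)

/-- ★★ **(KL-H) FOR `T` FROM THE ZEROTH ENTRY ROW (node-00, `k ≤ m + K`)** — G1's six binders at `hk(b′, y) := ‖colOp T y b′‖_op`, `Θ_H = Θ_H^w := (L^d)^k·B₀·d(2(1+1∕ρ))^d`.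
[cite: Balaban1985BackgroundPropagators, (3.126) p.420, (3.132)–(3.133) p.422; Balaban1985Variational, (88) p.291; Balaban1984PropagatorsII, Lemma 2.1 (2.61) p.234] -/
theorem klH_of_entryBounds (hΩ : ∀ x, x ∈ Ω k) (hk : k ≤ (F.P K).m + (F.P K).K) {B₀ ρ : ℝ} (hB₀ : 0 ≤ B₀) (hρ : 0 < ρ)
    (h0 : ∀ y'' y : PBond (F.P K) k, entry0 F N K k Ω U₀ levB T y'' y ≤ B₀ * Real.exp (-(ρ * (Site.tdist y''.src y.src : ℝ)))) :
    (∀ (b' : Bond (F.P K).d (fun _ => (F.P K).sitesPerDir 0)) (y : PBond (F.P K) k), 0 ≤ ‖colOp F N K k Ω U₀ levB T y b'‖) ∧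
    (∀ (y : PBond (F.P K) k) (Z : Matrix (Fin N) (Fin N) ℂ) (b' : Bond (F.P K).d (fun _ => (F.P K).sitesPerDir 0)),
      ‖flat115 (T ((NegSup.equiv (levWeight (F.L : ℝ) ((F.P K).eta k) levB 0) (Matrix (Fin N) (Fin N) ℂ)).symm (Pi.single y Z))) b'‖ ≤ ‖colOp F N K k Ω U₀ levB T y b'‖ * ‖Z‖) ∧
    (0 ≤ ((((F.P K).L ^ (F.P K).d) ^ k : ℕ) : ℝ) * (B₀ * ((F.P K).d * (2 * (1 + 1 / ρ)) ^ (F.P K).d))) ∧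
    (∀ y : PBond (F.P K) k, ∑ b' : Bond (F.P K).d (fun _ => (F.P K).sitesPerDir 0), ‖colOp F N K k Ω U₀ levB T y b'‖ ≤ ((((F.P K).L ^ (F.P K).d) ^ k : ℕ) : ℝ) * (B₀ * ((F.P K).d * (2 * (1 + 1 / ρ)) ^ (F.P K).d))) ∧
    (∀ (bb : Bond (F.P K).d (fun _ => (F.P K).sitesPerDir 0)) (y : PBond (F.P K) k), ∑ b' : Bond (F.P K).d (fun _ => (F.P K).sitesPerDir 0),
        levWeight (F.L : ℝ) ((F.P K).eta k) (bondLevLit F Ω k) 3 bb / levWeight (F.L : ℝ) ((F.P K).eta k) (bondLevLit F Ω k) 3 b' * ‖colOp F N K k Ω U₀ levB T y b'‖ ≤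
      ((((F.P K).L ^ (F.P K).d) ^ k : ℕ) : ℝ) * (B₀ * ((F.P K).d * (2 * (1 + 1 / ρ)) ^ (F.P K).d))) := by
  have hC0 : (0 : ℝ) ≤ (F.P K).d * (2 * (1 + 1 / ρ)) ^ (F.P K).d := by positivity
  have hcol : ∀ y : PBond (F.P K) k, ∑ y'' : PBond (F.P K) k, entry0 F N K k Ω U₀ levB T y'' y ≤ B₀ * ((F.P K).d * (2 * (1 + 1 / ρ)) ^ (F.P K).d) := by
    intro y
    calc ∑ y'' : PBond (F.P K) k, entry0 F N K k Ω U₀ levB T y'' y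
        ≤ ∑ y'' : PBond (F.P K) k, B₀ * Real.exp (-(ρ * (Site.tdist y.src y''.src : ℝ))) := Finset.sum_le_sum fun y'' _ => by rw [tdist_comm_rec F K]; exact h0 y'' y
      _ = B₀ * ∑ y'' : PBond (F.P K) k, Real.exp (-(ρ * (Site.tdist y.src y''.src : ℝ))) := by rw [Finset.mul_sum]
      _ ≤ B₀ * ((F.P K).d * (2 * (1 + 1 / ρ)) ^ (F.P K).d) := mul_le_mul_of_nonneg_left (rowSum_PBond_le F K k y hρ) hB₀
  have hsum : ∀ y : PBond (F.P K) k, ∑ b' : Bond (F.P K).d (fun _ => (F.P K).sitesPerDir 0), ‖colOp F N K k Ω U₀ levB T y b'‖ ≤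
      ((((F.P K).L ^ (F.P K).d) ^ k : ℕ) : ℝ) * (B₀ * ((F.P K).d * (2 * (1 + 1 / ρ)) ^ (F.P K).d)) := fun y =>
    (sum_opNorm_colOp_le F N K k Ω U₀ levB T hk y).trans (mul_le_mul_of_nonneg_left (hcol y) (Nat.cast_nonneg _))
  refine ⟨fun b' y => ContinuousLinearMap.opNorm_nonneg _, fun y Z b' => ?_, mul_nonneg (Nat.cast_nonneg _) (mul_nonneg hB₀ hC0), hsum, fun bb y => ?_⟩
  · rw [flat115_single]; exact ContinuousLinearMap.le_opNorm _ _
  · calc ∑ b' : Bond (F.P K).d (fun _ => (F.P K).sitesPerDir 0), levWeight (F.L : ℝ) ((F.P K).eta k) (bondLevLit F Ω k) 3 bb / levWeight (F.L : ℝ) ((F.P K).eta k) (bondLevLit F Ω k) 3 b' *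
            ‖colOp F N K k Ω U₀ levB T y b'‖
        = ∑ b' : Bond (F.P K).d (fun _ => (F.P K).sitesPerDir 0), ‖colOp F N K k Ω U₀ levB T y b'‖ := Finset.sum_congr rfl fun b' _ => by
          rw [levWeight_bondLevLit_eq_one_pow F K k Ω hΩ 3 bb, levWeight_bondLevLit_eq_one_pow F K k Ω hΩ 3 b', div_one, one_mul]
      _ ≤ _ := hsum y

/-! ## §5 (KL-N) for a composite `S ∘ T`: PT-B G1's one-block letter of a current reader of `T` -/

variable (S : Space115Lit F N K k Ω U₀ →L[ℂ] NegSizeLit F N K k Ω 3)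

/-- **THE FINE COLUMN OF `S ∘ T`**: `X ↦ (S(T(δ_y X)))(b′) : V →L[ℂ] V` (`S` any current reader, e.g. def-Y's `DeltaPiCurOfRecord … Gp Q′`). [cite: Balaban1985Variational, (87)–(88) p.291, (130) p.298] -/
def nColOp (y : PBond (F.P K) k) (b' : Bond (F.P K).d (fun _ => (F.P K).sitesPerDir 0)) : Matrix (Fin N) (Fin N) ℂ →L[ℂ] Matrix (Fin N) (Fin N) ℂ :=
  LinearMap.toContinuousLinearMap ((NegSup.evalCLM ℂ (levWeight (F.L : ℝ) ((F.P K).eta k) (bondLevLit F Ω k) 3) b').toLinearMap ∘ₗ S.toLinearMap ∘ₗ T.toLinearMap ∘ₗ singleBIdx F N K k levB y)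

/-- Unfolding `nColOp` in G1's spelling of `δ_y Z`. [cite: Balaban1985Variational, (88) p.291 (bookkeeping)] -/
theorem nColOp_apply (y : PBond (F.P K) k) (b' : Bond (F.P K).d (fun _ => (F.P K).sitesPerDir 0)) (Z : Matrix (Fin N) (Fin N) ℂ) :
    nColOp F N K k Ω U₀ levB T S y b' Z = NegSup.equiv (levWeight (F.L : ℝ) ((F.P K).eta k) (bondLevLit F Ω k) 3) (Matrix (Fin N) (Fin N) ℂ) (S (T ((NegSup.equiv (levWeight (F.L : ℝ) ((F.P K).eta k) levB 0) (Matrix (Fin N) (Fin N) ℂ)).symm (Pi.single y Z)))) b' := rfl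

open Classical in
/-- **`sup_{x∈Δ(y″)}|(ST)_{μν}(x, y)|`** — the (130)-shape block-sup entry of `S ∘ T`. [cite: Balaban1985Variational, (130) p.298, (88) p.291] -/
def nEntry0 (y'' y : PBond (F.P K) k) : ℝ :=
  fsup fun b' : Bond (F.P K).d (fun _ => (F.P K).sitesPerDir 0) => if blkOfBond F K k b' = y'' then ‖nColOp F N K k Ω U₀ levB T S y b'‖ else 0

/-- `‖nColOp S T y b′‖ ≤ nEntry0 S T Δ⁻¹(b′) y`. [cite: Balaban1985Variational, (130) p.298 (bookkeeping)] -/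
theorem opNorm_nColOp_le_nEntry0 (y : PBond (F.P K) k) (b' : Bond (F.P K).d (fun _ => (F.P K).sitesPerDir 0)) :
    ‖nColOp F N K k Ω U₀ levB T S y b'‖ ≤ nEntry0 F N K k Ω U₀ levB T S (blkOfBond F K k b') y := by
  classical
  unfold nEntry0
  refine le_trans (le_of_eq ?_) (le_fsup _ b')
  rw [if_pos rfl]

/-- ★★ **(KL-N) FOR `S ∘ T` FROM THE (130)-SHAPE ENTRY ROW (node-00, `k ≤ m + K`)** — G1's six binders at `hk′(b′, y) := ‖nColOp S T y b′‖_op`, `Θ′ := (L^d)^k·B₀·d(2(1+1∕ρ))^d` (NOT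
k-free; G1 pairs it with (KL-C)'s `G ~ η^d`), `N₁ := B₀·d(2(1+1∕ρ))^d`. [cite: Balaban1985Variational, (87)–(88) p.291, (130) p.298; Balaban1985BackgroundPropagators, (3.132) p.422; Balaban1984PropagatorsII, (2.61) p.234] -/
theorem klN_of_nEntryBounds (hΩ : ∀ x, x ∈ Ω k) (hk : k ≤ (F.P K).m + (F.P K).K) {B₀ ρ : ℝ} (hB₀ : 0 ≤ B₀) (hρ : 0 < ρ)
    (h0 : ∀ y'' y : PBond (F.P K) k, nEntry0 F N K k Ω U₀ levB T S y'' y ≤ B₀ * Real.exp (-(ρ * (Site.tdist y''.src y.src : ℝ)))) :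
    (∀ (b' : Bond (F.P K).d (fun _ => (F.P K).sitesPerDir 0)) (y : PBond (F.P K) k), 0 ≤ ‖nColOp F N K k Ω U₀ levB T S y b'‖) ∧
    (∀ (y : PBond (F.P K) k) (Z : Matrix (Fin N) (Fin N) ℂ) (b' : Bond (F.P K).d (fun _ => (F.P K).sitesPerDir 0)),
      ‖NegSup.equiv (levWeight (F.L : ℝ) ((F.P K).eta k) (bondLevLit F Ω k) 3) (Matrix (Fin N) (Fin N) ℂ) (S (T ((NegSup.equiv (levWeight (F.L : ℝ) ((F.P K).eta k) levB 0) (Matrix (Fin N) (Fin N) ℂ)).symm (Pi.single y Z)))) b'‖ ≤ ‖nColOp F N K k Ω U₀ levB T S y b'‖ * ‖Z‖) ∧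
    (0 ≤ ((((F.P K).L ^ (F.P K).d) ^ k : ℕ) : ℝ) * (B₀ * ((F.P K).d * (2 * (1 + 1 / ρ)) ^ (F.P K).d))) ∧
    (∀ (bb : Bond (F.P K).d (fun _ => (F.P K).sitesPerDir 0)) (y : PBond (F.P K) k), ∑ b' : Bond (F.P K).d (fun _ => (F.P K).sitesPerDir 0),
        levWeight (F.L : ℝ) ((F.P K).eta k) (bondLevLit F Ω k) 3 bb / levWeight (F.L : ℝ) ((F.P K).eta k) (bondLevLit F Ω k) 1 b' * ‖nColOp F N K k Ω U₀ levB T S y b'‖ ≤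
      ((((F.P K).L ^ (F.P K).d) ^ k : ℕ) : ℝ) * (B₀ * ((F.P K).d * (2 * (1 + 1 / ρ)) ^ (F.P K).d))) ∧
    (0 ≤ B₀ * ((F.P K).d * (2 * (1 + 1 / ρ)) ^ (F.P K).d)) ∧
    (∀ b' : Bond (F.P K).d (fun _ => (F.P K).sitesPerDir 0), ∑ y : PBond (F.P K) k,
        levWeight (F.L : ℝ) ((F.P K).eta k) (bondLevLit F Ω k) 3 b' / levWeight (F.L : ℝ) ((F.P K).eta k) levB 0 y * ‖nColOp F N K k Ω U₀ levB T S y b'‖ ≤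
      B₀ * ((F.P K).d * (2 * (1 + 1 / ρ)) ^ (F.P K).d)) := by
  have hC0 : (0 : ℝ) ≤ (F.P K).d * (2 * (1 + 1 / ρ)) ^ (F.P K).d := by positivity
  have hcol : ∀ y : PBond (F.P K) k, ∑ y'' : PBond (F.P K) k, nEntry0 F N K k Ω U₀ levB T S y'' y ≤ B₀ * ((F.P K).d * (2 * (1 + 1 / ρ)) ^ (F.P K).d) := by
    intro y
    calc ∑ y'' : PBond (F.P K) k, nEntry0 F N K k Ω U₀ levB T S y'' y
        ≤ ∑ y'' : PBond (F.P K) k, B₀ * Real.exp (-(ρ * (Site.tdist y.src y''.src : ℝ))) := Finset.sum_le_sum fun y'' _ => by rw [tdist_comm_rec F K]; exact h0 y'' y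
      _ = B₀ * ∑ y'' : PBond (F.P K) k, Real.exp (-(ρ * (Site.tdist y.src y''.src : ℝ))) := by rw [Finset.mul_sum]
      _ ≤ B₀ * ((F.P K).d * (2 * (1 + 1 / ρ)) ^ (F.P K).d) := mul_le_mul_of_nonneg_left (rowSum_PBond_le F K k y hρ) hB₀
  have hsum : ∀ y : PBond (F.P K) k, ∑ b' : Bond (F.P K).d (fun _ => (F.P K).sitesPerDir 0), ‖nColOp F N K k Ω U₀ levB T S y b'‖ ≤
      ((((F.P K).L ^ (F.P K).d) ^ k : ℕ) : ℝ) * (B₀ * ((F.P K).d * (2 * (1 + 1 / ρ)) ^ (F.P K).d)) := fun y => by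
    refine le_trans (Finset.sum_le_sum fun b' _ => opNorm_nColOp_le_nEntry0 F N K k Ω U₀ levB T S y b') ?_
    exact (sum_over_blocks_le F K k hk (fun y'' => nEntry0 F N K k Ω U₀ levB T S y'' y) (fun _ => fsup_nonneg _)).trans
      (mul_le_mul_of_nonneg_left (hcol y) (Nat.cast_nonneg _))
  have hrow : ∀ b' : Bond (F.P K).d (fun _ => (F.P K).sitesPerDir 0), ∑ y : PBond (F.P K) k, ‖nColOp F N K k Ω U₀ levB T S y b'‖ ≤ B₀ * ((F.P K).d * (2 * (1 + 1 / ρ)) ^ (F.P K).d) := by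
    intro b'
    calc ∑ y : PBond (F.P K) k, ‖nColOp F N K k Ω U₀ levB T S y b'‖
        ≤ ∑ y : PBond (F.P K) k, B₀ * Real.exp (-(ρ * (Site.tdist (blkOfBond F K k b').src y.src : ℝ))) :=
          Finset.sum_le_sum fun y _ => (opNorm_nColOp_le_nEntry0 F N K k Ω U₀ levB T S y b').trans (h0 _ y)
      _ = B₀ * ∑ y : PBond (F.P K) k, Real.exp (-(ρ * (Site.tdist (blkOfBond F K k b').src y.src : ℝ))) := by rw [Finset.mul_sum]
      _ ≤ B₀ * ((F.P K).d * (2 * (1 + 1 / ρ)) ^ (F.P K).d) := mul_le_mul_of_nonneg_left (rowSum_PBond_le F K k _ hρ) hB₀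
  refine ⟨fun b' y => ContinuousLinearMap.opNorm_nonneg _, fun y Z b' => ?_, mul_nonneg (Nat.cast_nonneg _) (mul_nonneg hB₀ hC0), fun bb y => ?_,
    mul_nonneg hB₀ hC0, fun b' => ?_⟩
  · rw [← nColOp_apply]; exact ContinuousLinearMap.le_opNorm _ _
  · calc ∑ b' : Bond (F.P K).d (fun _ => (F.P K).sitesPerDir 0), levWeight (F.L : ℝ) ((F.P K).eta k) (bondLevLit F Ω k) 3 bb / levWeight (F.L : ℝ) ((F.P K).eta k) (bondLevLit F Ω k) 1 b' *
            ‖nColOp F N K k Ω U₀ levB T S y b'‖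
        = ∑ b' : Bond (F.P K).d (fun _ => (F.P K).sitesPerDir 0), ‖nColOp F N K k Ω U₀ levB T S y b'‖ := Finset.sum_congr rfl fun b' _ => by
          rw [levWeight_bondLevLit_eq_one_pow F K k Ω hΩ 3 bb, levWeight_bondLevLit_eq_one_pow F K k Ω hΩ 1 b', div_one, one_mul]
      _ ≤ _ := hsum y
  · calc ∑ y : PBond (F.P K) k, levWeight (F.L : ℝ) ((F.P K).eta k) (bondLevLit F Ω k) 3 b' / levWeight (F.L : ℝ) ((F.P K).eta k) levB 0 y *
            ‖nColOp F N K k Ω U₀ levB T S y b'‖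
        = ∑ y : PBond (F.P K) k, ‖nColOp F N K k Ω U₀ levB T S y b'‖ := Finset.sum_congr rfl fun y _ => by
          rw [levWeight_bondLevLit_eq_one_pow F K k Ω hΩ 3 b', levWeight_apply, pow_zero, div_one, one_mul]
      _ ≤ _ := hrow b'

end Summit.QuantumFields.YangMills.BalabanUVNodes.N07KernelEntriesOfRecord
end
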